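import Summits.ResolutionOfSingularities.ResolutionOfSingularities.Theorems.MarkedTransferCampaignW46MohWindowSurface
import Literature.AlgebraicGeometry.Resolution.AlterationsFormalCoordinates
import HarnessLib

/-!
# [OURS · L1 W4.6 rung (iii-2)] THE SURFACE WINDOW IN FORMAL COORDINATES — first brick of the ENTRANCE door of the
# scheme-level (H2) transport: at a point of the window regime, `𝒪̂_{Z,ξ} ≅ κ⟦X₀, X₁, X₂⟧` with `x, y, z ↦ X₀, X₁, X₂` and
# `J_ξ · 𝒪̂ ↦ (X₂^b + F)`, `F ∈ (X₀, X₁)^d`, `F ∉ 𝔪^(d+1)`, `b < d < 2b`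

Cell `res-hironaka`, LADDER-RESOLUTION rung L (D-0089), slot W4.6 rung (iii-2) «purely inseparable SURFACE Moh window,
isolated singular locus at every stage»; seat res-D-pv-050 AS res-L1-s46-pv-12 (gen 6). Host route MarkedTransfer,
`--kind proof --supports stmt-ResolutionOfSingularities-16155 --as helper`; no definition.

WHY. The (H2) heavy-side termination has a MODEL-LEVEL answer (res-L1-s46-pv-6, `…MohWindowShadeTermination*`: an
infinite in-window walk meets a formal `p`-fold curve) and, since this seat's `…MohWindowSurfaceFormalExit` (p514487 /
library p513608), a scheme-level EXIT door (a formal `p`-fold factor at a point of a stage contradicts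
`Regime.isolatedSing`). The ENTRANCE door — reading an in-regime stage in formal coordinates — starts here: Cohen's
structure theorem with PRESCRIBED regular system of parameters (tree `exists_ringEquiv_adicCompletion_mvPowerSeries_of_rsop`,
[Matsumura1987] Thm 29.7 with 28.3 (ii)) applied to the window presentation `MohWindowSurfaceAt` (o1, `…MohWindowSurface`
§1): the completion of the stalk is a formal power series ring in three variables over the residue field, the chosen
regular system of parameters `(x, y, z)` becoming the variables, and the window equation `z^b + f` becoming
`X₂^b + F` with `F` the image of `f` — still in the `d`-th power of the ideal `(X₀, X₁)` and still of order exactly `d`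
(faithful flatness of `𝒪 → 𝒪̂`: `𝔪̂^{d+1} ∩ 𝒪 = 𝔪^{d+1}`).  HONEST SCOPE NOTE: `F` is the image of an element of
the IDEAL power `(x, y)^d` (DESIGN POINT (PUR) of `MohWindowSurfaceAt`), so `F` may involve `X₂` in its terms of degree
`≥ d + 1`; the model ansatz `x^p + F(y_j, y_i)` of the shade files is the special case `F ∈ κ⟦X₀, X₁⟧` — this file does
NOT claim that reduction.

WHAT (kernel-checked, axioms standard; `𝒪̂` = Mathlib `AdicCompletion (maximalIdeal _) _`):
* `CampaignW46.MohWindowSurfaceAt.exists_formal_coordinates` — ring level: `MohWindowSurfaceAt b R I` and a subfield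
  `k₀ ⊆ R` ⇒ `∃ e : R̂ ≃+* κ⟦X_0, X_1, X_2⟧` (`κ = ResidueField R`), `d`, `F` with `b < d < 2b`,
  `F ∈ (X 0, X 1)^d`, `F ∉ 𝔪^(d+1)`, `I · R̂ ↦ (X 2 ^ b + F)` (as `Ideal.map` along `e ∘ (R → R̂)`).
* `CampaignW46.AmbientDatum.exists_isField_subring_stalk` — the base field `K` sits inside every stalk of an ambient datum.
* `CampaignW46.exists_formal_coordinates_of_mohWindowSurfaceIsolated` / `…_of_regimeMohWindowSurfaceInsep` — scheme level,
  at every `ξ ∈ Sing(E)` of a stage in the regime.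
What is NOT claimed: anything about the manuscript; the reduction of `F` to a series in `X₀, X₁` only; any blow-up step.

HONEST FRAMING. Nothing here is a statement of H. Hironaka's manuscript [Hironaka2017] (2017-03-23; Th. 16.6 p.84, Th. 16.13
p.87 — scope only, under adjudication); the regimes are OURS campaign definitions (res-L1-type-o1). AI-written; AI review is
weaker than expert review. No `sorry`; axioms standard.
-/

noncomputable section

set_option linter.dupNamespace false -- mandated namespace of this single-conjunct summit

open CategoryTheory AlgebraicGeometry TopologicalSpace IsLocalRing

namespace Summit.ResolutionOfSingularities.ResolutionOfSingularities.Theorems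

namespace CampaignW46

open Literature.AlgebraicGeometry.Resolution
open Literature.AlgebraicGeometry.Hironaka2017.S02Preliminaries
open Literature.AlgebraicGeometry.Hironaka2017.Datum

universe u

/-! ## §1 Ring level: the window presentation in Cohen coordinates -/

/-- [OURS · L1 W4.6 rung (iii-2)] NOT a statement of the manuscript. **The surface window in formal coordinates.** If
`I ⊆ R` has a window presentation of exponent `b` (`MohWindowSurfaceAt b R I`: `R` regular local of embedding dimension
`3`, `𝔪 = (x, y, z)`, `I = (z^b + f)`, `f ∈ (x, y)^d ∖ 𝔪^{d+1}`, `b < d < 2b`) and `R` contains a field `k₀`, then there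
are a ring isomorphism `e : R̂ ≃+* κ⟦X₀, X₁, X₂⟧` (`κ` the residue field of `R`) with `e x = X₀, e y = X₁, e z = X₂`,
and `F := e f` with `F ∈ (X₀, X₁)^d`, `F ∉ 𝔪^{d+1}` and `I · R̂ = (X₂^b + F)` read through `e`.
[cite: Matsumura1987, Thm 29.7 (with Thm 28.3 (ii)); Thm 8.14 (faithful flatness of the completion)] -/
theorem MohWindowSurfaceAt.exists_formal_coordinates {R : Type u} [CommRing R] [IsLocalRing R] {b : ℕ} {I : Ideal R}
    (h : MohWindowSurfaceAt b R I) (k₀ : Subring R) (hk₀ : IsField k₀) :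
    ∃ (e : AdicCompletion (maximalIdeal R) R ≃+* MvPowerSeries (Fin 3) (ResidueField R)) (d : ℕ)
      (F : MvPowerSeries (Fin 3) (ResidueField R)),
      b < d ∧ d < 2 * b ∧
        F ∈ Ideal.span {(MvPowerSeries.X 0 : MvPowerSeries (Fin 3) (ResidueField R)), MvPowerSeries.X 1} ^ d ∧
        F ∉ maximalIdeal (MvPowerSeries (Fin 3) (ResidueField R)) ^ (d + 1) ∧
        I.map ((e : _ →+* MvPowerSeries (Fin 3) (ResidueField R)).comp
          (algebraMap R (AdicCompletion (maximalIdeal R) R))) =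
          Ideal.span {MvPowerSeries.X 2 ^ b + F} := by
  obtain ⟨hreg, hdim, x, y, z, hm, d, f, hbd, hd2b, hfmem, hfnot, hI⟩ := h
  -- `dim R = 3`
  have hd3 : ringKrullDim R = (3 : ℕ) := by
    have h1 := IsRegularLocalRing.spanFinrank_maximalIdeal (R := R)
    rw [hdim] at h1
    exact h1.symm
  -- the regular system of parameters `(x, y, z)`
  have hrange : Set.range ![x, y, z] = {x, y, z} := by
    ext t
    simp only [Matrix.range_cons, Matrix.range_empty, Set.union_empty, Set.singleton_union, Set.mem_insert_iff,
      Set.mem_singleton_iff]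
  have hz : Ideal.span (Set.range ![x, y, z]) = maximalIdeal R := by rw [hrange, hm]
  obtain ⟨e, he⟩ := exists_ringEquiv_adicCompletion_mvPowerSeries_of_rsop R k₀ hk₀
    (RingEquiv.refl (ResidueField R)) ![x, y, z] hz hd3
  set φ : R →+* MvPowerSeries (Fin 3) (ResidueField R) :=
    (e : _ →+* MvPowerSeries (Fin 3) (ResidueField R)).comp (algebraMap R (AdicCompletion (maximalIdeal R) R))
    with hφ
  have h0 : φ x = MvPowerSeries.X 0 := by rw [hφ]; simpa using he 0
  have h1 : φ y = MvPowerSeries.X 1 := by rw [hφ]; simpa using he 1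
  have h2 : φ z = MvPowerSeries.X 2 := by rw [hφ]; simpa using he 2
  refine ⟨e, d, φ f, hbd, hd2b, ?_, ?_, ?_⟩
  · -- `F ∈ (X₀, X₁)^d`
    have hle : (Ideal.span {x, y} ^ d).map φ ≤
        Ideal.span {(MvPowerSeries.X 0 : MvPowerSeries (Fin 3) (ResidueField R)), MvPowerSeries.X 1} ^ d := by
      rw [Ideal.map_pow, Ideal.map_span, Set.image_pair, h0, h1]
    exact hle (Ideal.mem_map_of_mem φ hfmem)
  · -- `F ∉ 𝔪^(d+1)`: `𝔪_S^(d+1) = φ(𝔪^(d+1))` and `φ⁻¹(φ(𝔪^(d+1))) = 𝔪^(d+1)` (faithful flatness, `e` bijective)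
    intro hF
    apply hfnot
    haveI : Module.Flat R (AdicCompletion (maximalIdeal R) R) := AdicCompletion.flat_of_isNoetherian _
    haveI : Module.FaithfullyFlat R (AdicCompletion (maximalIdeal R) R) :=
      Module.FaithfullyFlat.of_flat_of_isLocalHom
    have hmS : maximalIdeal (MvPowerSeries (Fin 3) (ResidueField R)) = (maximalIdeal R).map φ := by
      rw [hφ, ← Ideal.map_map, ← AdicCompletion.maximalIdeal_eq_map]
      exact (IsLocalRing.map_ringEquiv_maximalIdeal e).symm
    rw [hmS, ← Ideal.map_pow, ← Ideal.mem_comap] at hF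
    have hbij : Function.Bijective
        ((e : AdicCompletion (maximalIdeal R) R ≃+* MvPowerSeries (Fin 3) (ResidueField R)) :
          AdicCompletion (maximalIdeal R) R →+* MvPowerSeries (Fin 3) (ResidueField R)) := e.bijective
    have hcomap : ((maximalIdeal R ^ (d + 1)).map φ).comap φ = maximalIdeal R ^ (d + 1) := by
      rw [hφ, ← Ideal.map_map, ← Ideal.comap_comap, Ideal.comap_map_of_bijective _ hbij]
      exact Ideal.comap_map_eq_self_of_faithfullyFlat _
    rwa [hcomap] at hF
  · -- the equation
    rw [hI, Ideal.map_span, Set.image_singleton, map_add, map_pow, h2]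

/-! ## §2 Scheme level: at the singular points of a stage of the window regimes -/

variable {p : ℕ} [Fact p.Prime] {K : Type u} [Field K] [CharP K p]

/-- The base field `K` of an ambient datum sits inside every stalk `𝒪_{Z,ξ}` (as the image of
`K = Γ(Spec K) → Γ(Z) → 𝒪_{Z,ξ}`), so the stalks «contain a field» in the sense of Cohen's theorem. [folklore] -/
theorem AmbientDatum.exists_isField_subring_stalk (A : AmbientDatum p K) (ξ : A.Z) :
    ∃ k₀ : Subring (A.Z.presheaf.stalk ξ), IsField k₀ := by
  let φ : K →+* A.Z.presheaf.stalk ξ :=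
    (A.Z.presheaf.germ ⊤ ξ trivial).hom.comp (A.hom.appTop.hom.comp (Scheme.ΓSpecIso (.of K)).inv.hom)
  have hφ : Function.Injective φ := φ.injective
  refine ⟨φ.range, ?_⟩
  exact MulEquiv.isField (Field.toIsField K) (RingEquiv.ofBijective φ.rangeRestrict
    ⟨fun a b hab => hφ (congrArg Subtype.val hab), φ.rangeRestrict_surjective⟩).symm.toMulEquiv

/-- [OURS · L1 W4.6 rung (iii-2)] NOT a statement of the manuscript. **Formal coordinates at a singular point of a stage of
`Regime.mohWindowSurfaceIsolated`**: `𝒪̂_{Z,ξ} ≅ κ(ξ)⟦X₀, X₁, X₂⟧` carrying `J_ξ 𝒪̂` to `(X₂^b + F)`, `F ∈ (X₀, X₁)^d`,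
`F ∉ 𝔪^{d+1}`, `b < d < 2b`. [cite: Matsumura1987, Thm 29.7 (with Thm 28.3 (ii))] -/
theorem exists_formal_coordinates_of_mohWindowSurfaceIsolated (A : AmbientDatum p K) (E : IdealExponent A.Z)
    (hRg : Regime.mohWindowSurfaceIsolated A E) {ξ : A.Z} (hξ : ξ ∈ E.sing) :
    ∃ (e : AdicCompletion (maximalIdeal (A.Z.presheaf.stalk ξ)) (A.Z.presheaf.stalk ξ) ≃+*
        MvPowerSeries (Fin 3) (ResidueField (A.Z.presheaf.stalk ξ))) (d : ℕ)
      (F : MvPowerSeries (Fin 3) (ResidueField (A.Z.presheaf.stalk ξ))),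
      E.b < d ∧ d < 2 * E.b ∧
        F ∈ Ideal.span {(MvPowerSeries.X 0 : MvPowerSeries (Fin 3) (ResidueField (A.Z.presheaf.stalk ξ))),
          MvPowerSeries.X 1} ^ d ∧
        F ∉ maximalIdeal (MvPowerSeries (Fin 3) (ResidueField (A.Z.presheaf.stalk ξ))) ^ (d + 1) ∧
        (stalkIdeal E.J ξ).map ((e : _ →+* _).comp (algebraMap (A.Z.presheaf.stalk ξ)
          (AdicCompletion (maximalIdeal (A.Z.presheaf.stalk ξ)) (A.Z.presheaf.stalk ξ)))) =
          Ideal.span {MvPowerSeries.X 2 ^ E.b + F} := by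
  obtain ⟨k₀, hk₀⟩ := AmbientDatum.exists_isField_subring_stalk A ξ
  exact (hRg.2 ξ hξ).exists_formal_coordinates k₀ hk₀

/-- [OURS · L1 W4.6 rung (iii-2)] NOT a statement of the manuscript. The same at a singular point of a stage of the rung's
regime `regimeMohWindowSurfaceInsep` (there `b = p`). [cite: Matsumura1987, Thm 29.7 (with Thm 28.3 (ii))] -/
theorem exists_formal_coordinates_of_regimeMohWindowSurfaceInsep (A : AmbientDatum p K) (E : IdealExponent A.Z)
    (hRg : regimeMohWindowSurfaceInsep A E) {ξ : A.Z} (hξ : ξ ∈ E.sing) :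
    ∃ (e : AdicCompletion (maximalIdeal (A.Z.presheaf.stalk ξ)) (A.Z.presheaf.stalk ξ) ≃+*
        MvPowerSeries (Fin 3) (ResidueField (A.Z.presheaf.stalk ξ))) (d : ℕ)
      (F : MvPowerSeries (Fin 3) (ResidueField (A.Z.presheaf.stalk ξ))),
      p < d ∧ d < 2 * p ∧
        F ∈ Ideal.span {(MvPowerSeries.X 0 : MvPowerSeries (Fin 3) (ResidueField (A.Z.presheaf.stalk ξ))),
          MvPowerSeries.X 1} ^ d ∧
        F ∉ maximalIdeal (MvPowerSeries (Fin 3) (ResidueField (A.Z.presheaf.stalk ξ))) ^ (d + 1) ∧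
        (stalkIdeal E.J ξ).map ((e : _ →+* _).comp (algebraMap (A.Z.presheaf.stalk ξ)
          (AdicCompletion (maximalIdeal (A.Z.presheaf.stalk ξ)) (A.Z.presheaf.stalk ξ)))) =
          Ideal.span {MvPowerSeries.X 2 ^ p + F} := by
  obtain ⟨hIso, hb⟩ := (regimeMohWindowSurfaceInsep_iff A E).mp hRg
  obtain ⟨e, d, F, h1, h2, h3, h4, h5⟩ := exists_formal_coordinates_of_mohWindowSurfaceIsolated A E hIso hξ
  rw [hb] at h1 h2 h5
  exact ⟨e, d, F, h1, h2, h3, h4, h5⟩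

end CampaignW46

end Summit.ResolutionOfSingularities.ResolutionOfSingularities.Theorems

end
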